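import Mathlib
import HarnessLib

/-!
# Schur's test through the Gram matrix: `‖T w‖² ≤ (max row sum of |T T*|) ‖w‖²` — PROVED

Topic `Literature/Analysis/Matrix`.  For a finite complex matrix `T = (T_{rτ})` the operator norm
satisfies `‖T‖² = ‖T T*‖ ≤ max_r ∑_{r'} |(T T*)_{r r'}|` (Gershgorin / Schur row-sum bound applied
to the Hermitian matrix `T T*`; Kunisky–Yu 2022 use exactly this in (133): "applying the Gershgorin
circle theorem, `‖T⁽²⁾‖² = ‖T⁽²⁾ T⁽²⁾ᵀ‖ ≤ max_a ∑_b |(T⁽²⁾T⁽²⁾ᵀ)_{ab}|`").  We prove it as an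
inequality between finite sums, with no operator norms:

  `∑_r |∑_τ T_{rτ} w_τ|² ≤ R ∑_τ |w_τ|²`  whenever  `∑_{r'} |∑_τ T_{rτ} conj T_{r'τ}| ≤ R` for all `r`

(`sum_norm_sq_mulVec_le_of_gram_rowSum_le`).  Proof: with `v = T w` and `u = T* v`,
`‖v‖² = ⟨w, u⟩ ≤ ‖w‖ ‖u‖` and `‖u‖² = ∑_{r,r'} v_r conj(v_{r'}) conj((TT*)_{rr'}) ≤ R ‖v‖²`
(`|ab| ≤ (|a|² + |b|²)/2`, rows and columns of the Hermitian `T T*` have the same absolute sums).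

## References

* D. Kunisky, X. Yu, arXiv:2211.02713 (2022), Proposition 4.15 and (133).  [KuniskyYu2022]
* R. A. Horn, C. R. Johnson, *Matrix Analysis*, 2nd ed. (2013), §5.6 (Schur test) / §6.1.
-/

noncomputable section

open Finset

namespace Literature.Analysis.Matrix

section Gram

variable {α β : Type*} [Fintype α] [Fintype β]

/-- **Cauchy–Schwarz** for finite complex sums, in norm form:
`|∑ a_i conj b_i| ≤ (∑ |a_i|²)^{1/2} (∑ |b_i|²)^{1/2}`, squared. [folklore] -/
theorem norm_sum_mul_conj_sq_le (a b : β → ℂ) :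
    ‖∑ i : β, a i * (starRingEnd ℂ) (b i)‖ ^ 2 ≤
      (∑ i : β, ‖a i‖ ^ 2) * ∑ i : β, ‖b i‖ ^ 2 := by
  have h1 : ‖∑ i : β, a i * (starRingEnd ℂ) (b i)‖ ≤ ∑ i : β, ‖a i‖ * ‖b i‖ := by
    refine (norm_sum_le _ _).trans (Finset.sum_le_sum fun i _ => ?_)
    rw [norm_mul, Complex.norm_conj]
  have h2 : (∑ i : β, ‖a i‖ * ‖b i‖) ^ 2 ≤ (∑ i : β, ‖a i‖ ^ 2) * ∑ i : β, ‖b i‖ ^ 2 :=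
    Finset.sum_mul_sq_le_sq_mul_sq _ _ _
  have h0 : 0 ≤ ‖∑ i : β, a i * (starRingEnd ℂ) (b i)‖ := norm_nonneg _
  calc ‖∑ i : β, a i * (starRingEnd ℂ) (b i)‖ ^ 2 ≤ (∑ i : β, ‖a i‖ * ‖b i‖) ^ 2 := by
        gcongr
    _ ≤ _ := h2

/-- **Schur's test via the Gram matrix** (Kunisky–Yu (133), "`‖X‖² = ‖XXᵀ‖ ≤ max_a ∑_b |(XXᵀ)_{ab}|`",
as a finite-sum inequality): if every absolute row sum of `T T*` is at most `R ≥ 0`, then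
`∑_r |(T w)_r|² ≤ R ∑_τ |w_τ|²`. [cite: KuniskyYu2022, Proposition 4.15] -/
theorem sum_norm_sq_mulVec_le_of_gram_rowSum_le (T : α → β → ℂ) {R : ℝ} (hR0 : 0 ≤ R)
    (hR : ∀ r : α, ∑ r' : α, ‖∑ τ : β, T r τ * (starRingEnd ℂ) (T r' τ)‖ ≤ R) (w : β → ℂ) :
    ∑ r : α, ‖∑ τ : β, T r τ * w τ‖ ^ 2 ≤ R * ∑ τ : β, ‖w τ‖ ^ 2 := by
  set v : α → ℂ := fun r => ∑ τ : β, T r τ * w τ with hv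
  set u : β → ℂ := fun τ => ∑ r : α, v r * (starRingEnd ℂ) (T r τ) with hu
  set M : α → α → ℂ := fun r r' => ∑ τ : β, T r τ * (starRingEnd ℂ) (T r' τ) with hM
  set S : ℝ := ∑ r : α, ‖v r‖ ^ 2 with hS
  have hS0 : 0 ≤ S := Finset.sum_nonneg fun r _ => by positivity
  have hns : ∀ z : ℂ, ((‖z‖ ^ 2 : ℝ) : ℂ) = z * (starRingEnd ℂ) z := fun z => by
    rw [Complex.mul_conj, Complex.normSq_eq_norm_sq]
  -- (1) `S = ∑_τ w_τ conj(u_τ)` hence `S² ≤ ‖w‖² ‖u‖²`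
  have h1 : ((S : ℝ) : ℂ) = ∑ τ : β, w τ * (starRingEnd ℂ) (u τ) := by
    rw [hS, Complex.ofReal_sum]
    simp_rw [hns]
    have hcu : ∀ τ : β, (starRingEnd ℂ) (u τ) = ∑ r : α, (starRingEnd ℂ) (v r) * T r τ := by
      intro τ
      rw [hu]
      simp only [map_sum, map_mul, Complex.conj_conj]
    simp_rw [hcu, Finset.mul_sum]
    rw [Finset.sum_comm]
    refine Finset.sum_congr rfl fun r _ => ?_
    rw [mul_comm, hv]
    simp only [Finset.mul_sum]
    refine Finset.sum_congr rfl fun τ _ => ?_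
    ring
  have h2 : S ^ 2 ≤ (∑ τ : β, ‖w τ‖ ^ 2) * ∑ τ : β, ‖u τ‖ ^ 2 := by
    have := norm_sum_mul_conj_sq_le w u
    rwa [← h1, Complex.norm_real, Real.norm_eq_abs, abs_of_nonneg hS0] at this
  -- (2) `‖u‖² ≤ R S`
  have h3 : ((∑ τ : β, ‖u τ‖ ^ 2 : ℝ) : ℂ) =
      ∑ r : α, ∑ r' : α, v r * (starRingEnd ℂ) (v r') * (starRingEnd ℂ) (M r r') := by
    rw [Complex.ofReal_sum]
    simp_rw [hns]
    have hexp : ∀ τ : β, u τ * (starRingEnd ℂ) (u τ) =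
        ∑ r : α, ∑ r' : α, v r * (starRingEnd ℂ) (v r') *
          ((starRingEnd ℂ) (T r τ) * T r' τ) := by
      intro τ
      rw [hu]
      simp only [map_sum, map_mul, Complex.conj_conj]
      rw [Finset.sum_mul_sum]
      refine Finset.sum_congr rfl fun r _ => Finset.sum_congr rfl fun r' _ => ?_
      ring
    simp_rw [hexp]
    rw [Finset.sum_comm]
    refine Finset.sum_congr rfl fun r _ => ?_
    rw [Finset.sum_comm]
    refine Finset.sum_congr rfl fun r' _ => ?_
    rw [hM]
    simp only [map_sum, map_mul, Complex.conj_conj]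
    rw [Finset.mul_sum]
  have hMsymm : ∀ r r' : α, ‖M r' r‖ = ‖M r r'‖ := by
    intro r r'
    have : M r' r = (starRingEnd ℂ) (M r r') := by
      rw [hM]
      simp only [map_sum, map_mul, Complex.conj_conj]
      refine Finset.sum_congr rfl fun τ _ => ?_
      ring
    rw [this, Complex.norm_conj]
  have h4 : ∑ τ : β, ‖u τ‖ ^ 2 ≤ R * S := by
    have h4a : ∑ τ : β, ‖u τ‖ ^ 2 ≤
        ∑ r : α, ∑ r' : α, ‖v r‖ * ‖v r'‖ * ‖M r r'‖ := by
      have := congrArg norm h3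
      rw [Complex.norm_real, Real.norm_eq_abs,
        abs_of_nonneg (Finset.sum_nonneg fun τ _ => by positivity)] at this
      rw [this]
      refine (norm_sum_le _ _).trans (Finset.sum_le_sum fun r _ => ?_)
      refine (norm_sum_le _ _).trans (Finset.sum_le_sum fun r' _ => ?_)
      rw [norm_mul, norm_mul, Complex.norm_conj, Complex.norm_conj]
    have h4b : ∀ r r' : α, ‖v r‖ * ‖v r'‖ * ‖M r r'‖ ≤
        (‖v r‖ ^ 2 * ‖M r r'‖ + ‖v r'‖ ^ 2 * ‖M r r'‖) / 2 := by
      intro r r'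
      have hm : 0 ≤ ‖M r r'‖ := norm_nonneg _
      nlinarith [sq_nonneg (‖v r‖ - ‖v r'‖), hm]
    have h4c : ∑ r : α, ∑ r' : α, ‖v r‖ * ‖v r'‖ * ‖M r r'‖ ≤
        (∑ r : α, ∑ r' : α, ‖v r‖ ^ 2 * ‖M r r'‖ +
          ∑ r : α, ∑ r' : α, ‖v r'‖ ^ 2 * ‖M r r'‖) / 2 := by
      rw [← Finset.sum_add_distrib, Finset.sum_div]
      refine Finset.sum_le_sum fun r _ => ?_
      rw [← Finset.sum_add_distrib, Finset.sum_div]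
      exact Finset.sum_le_sum fun r' _ => h4b r r'
    have hrow : ∑ r : α, ∑ r' : α, ‖v r‖ ^ 2 * ‖M r r'‖ ≤ R * S := by
      rw [hS, Finset.mul_sum]
      refine Finset.sum_le_sum fun r _ => ?_
      rw [← Finset.mul_sum, mul_comm]
      exact mul_le_mul_of_nonneg_right (hR r) (by positivity)
    have hcol : ∑ r : α, ∑ r' : α, ‖v r'‖ ^ 2 * ‖M r r'‖ ≤ R * S := by
      rw [Finset.sum_comm, hS, Finset.mul_sum]
      refine Finset.sum_le_sum fun r' _ => ?_
      rw [← Finset.mul_sum, mul_comm]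
      refine mul_le_mul_of_nonneg_right ?_ (by positivity)
      calc ∑ r : α, ‖M r r'‖ = ∑ r : α, ‖M r' r‖ := Finset.sum_congr rfl fun r _ => (hMsymm r r').symm
        _ ≤ R := hR r'
    linarith
  -- (3) conclude
  have h5 : S ^ 2 ≤ (∑ τ : β, ‖w τ‖ ^ 2) * (R * S) :=
    h2.trans (mul_le_mul_of_nonneg_left h4 (Finset.sum_nonneg fun τ _ => by positivity))
  have hw0 : 0 ≤ ∑ τ : β, ‖w τ‖ ^ 2 := Finset.sum_nonneg fun τ _ => by positivity
  by_cases hSpos : S = 0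
  · rw [hSpos]
    positivity
  · have hSp : 0 < S := lt_of_le_of_ne hS0 (Ne.symm hSpos)
    have : S ≤ (∑ τ : β, ‖w τ‖ ^ 2) * R := by
      have h6 : S * S ≤ ((∑ τ : β, ‖w τ‖ ^ 2) * R) * S := by nlinarith
      exact le_of_mul_le_mul_right h6 hSp
    linarith [mul_comm (∑ τ : β, ‖w τ‖ ^ 2) R]

end Gram

end Literature.Analysis.Matrix

end
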